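import Summits.Ventures.CertifiedArithmetic.LowPrec.GemmPrecRoundingG
import Summits.Ventures.CertifiedArithmetic.LowPrec.GemmTieChains
import HarnessLib

/-!
# GEMM worst case XLIX-a — the canonical E2M1² family for EVERY precision: the word, its
# piecewise-affine trajectory, its mass, and the one-binade RNE step lemma

HONEST FRAMING: certified error envelopes and provably optimal rounding/accumulation schemes for
low-precision formats under stated cost models; every table by two implementations; no hardware or
vendor claims.

Definitions and arithmetic for file XLIX-b (`GemmThetaLawE2M1Family`, the roundings and the closed
form) — everything here is precision-SYMBOLIC (`N = 2^(p-2)`, `2^manBits = 2N`) and closed by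
`omega` / `ring`; nothing is evaluated by `decide`.  In QUARTER UNITS the family `famZ N` is

  `2^{×(2N+1)}  1 | 3^{×N} | (2,3)^{×(N-1)} 2 | (6,4)^{×N} (9,8)^{×N} (18,16)^{×N} (36,32)^{×N} | 72 64 | (-64)^∞`

(values `½^{×(2N+1)} ¼ ¾^{×N} (½,¾)^{×(N-1)} ½ (3/2,1)^{×N} (9/4,2)^{×N} (9/2,4)^{×N} (9,8)^{×N} 18 16
-16 -16 …`; every letter is a product of two E2M1 data, `fam_mem` / `fam_letters`), and `trajN N`
is the claimed accumulator trajectory (exact sums `2k+2` on the prefix, then one grid step of the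
current binade per letter, constant `256N+256` from letter `13N+2` on).  The prefix has `13N+3`
letters and mass `Σ famZ = 141N + 136` quarter units (`sum_famZ`).

The rounding primitive for every precision: `rneSigMag_binade_step` — round-to-nearest-even of the
integer `(M+t)·u + r` (`M = 2^manBits`, `t < M`, `u = 2^{j+1}` the spacing of binade `j`, `r < u`)
is `(M + t + stepUp t r u)·u` with `stepUp ∈ {0,1}` decided by `2r` vs `u` and the parity of `t`
(from the landed `rneSigMag_of_binade` + `rneShiftNat_of_decomp`); `value_step` transports it to
`roundNE φ` on the quarter grid through `toRat_roundNE_quarter_prec` under `qexp φ ≤ -2` and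
`2^(manBits φ + 10) ≤ maxRat φ`.
References: [Higham2002, §4.2], [MullerEtAl2018HFPA, §6.1] (worst cases of recursive summation are
format-specific inputs); [RouhaniEtAl2023MX, Table 1] (E2M1).
-/

namespace Summit.Ventures.CertifiedArithmetic.LowPrec.Gemm

open Literature.ComputerArithmetic.FloatingPoint
open Literature.ComputerArithmetic.FloatingPoint.MiniFloat
open Finset

/-! ### One RNE step inside a binade, every precision -/

/-- The rounding increment of `(M+t)·u + r ↦` nearest multiple of `u`, ties to even: `0` below the
half-spacing, `1` above it, `t mod 2` at the tie (`M` even). [cite: IEEE7542019, §4.3.1] -/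
def stepUp (t r u : ℕ) : ℕ := if 2 * r < u then 0 else if u < 2 * r then 1 else t % 2

/-- THE BINADE STEP, EVERY PRECISION: with `M = 2^m` and spacing `u = 2^(j+1)` on the binade
`[M·u, 2M·u)`, the integer `(M+t)·u + r` (`t < M`, `r < u`) rounds to `(M + t + stepUp t r u)·u`.
[cite: IEEE7542019, §4.3.1; from `rneSigMag_of_binade`, `rneShiftNat_of_decomp`] -/
theorem rneSigMag_binade_step {m M t u j r : ℕ} (hM : 2 ^ m = M) (h2 : 2 ∣ M)
    (hu : 2 ^ (j + 1) = u) (ht : t < M) (hr : r < u) :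
    rneSigMag m ((M + t) * u + r) = (M + t + stepUp t r u) * u := by
  subst hM; subst hu
  have hlo : 2 ^ (m + (j + 1)) ≤ (2 ^ m + t) * 2 ^ (j + 1) + r :=
    calc 2 ^ (m + (j + 1)) = 2 ^ m * 2 ^ (j + 1) := pow_add _ _ _
      _ ≤ (2 ^ m + t) * 2 ^ (j + 1) := Nat.mul_le_mul_right _ (Nat.le_add_right _ _)
      _ ≤ _ := Nat.le_add_right _ _
  have hhi : (2 ^ m + t) * 2 ^ (j + 1) + r < 2 ^ (m + (j + 1) + 1) := by
    have e : 2 ^ (m + (j + 1) + 1) = (2 ^ m + 2 ^ m) * 2 ^ (j + 1) := by ring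
    have h1 : (2 ^ m + t + 1) * 2 ^ (j + 1) ≤ (2 ^ m + 2 ^ m) * 2 ^ (j + 1) :=
      Nat.mul_le_mul_right _ (by omega)
    have h3 : (2 ^ m + t) * 2 ^ (j + 1) + r < (2 ^ m + t + 1) * 2 ^ (j + 1) :=
      calc (2 ^ m + t) * 2 ^ (j + 1) + r < (2 ^ m + t) * 2 ^ (j + 1) + 2 ^ (j + 1) :=
            Nat.add_lt_add_left hr _
        _ = (2 ^ m + t + 1) * 2 ^ (j + 1) := by ring
    rw [e]; exact lt_of_lt_of_le h3 h1
  rw [rneSigMag_of_binade hlo hhi, rneShiftNat_of_decomp (2 ^ m + t) hr]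
  have hpar : (2 ^ m + t) % 2 = t % 2 := by obtain ⟨c, hc⟩ := h2; omega
  unfold stepUp
  rw [hpar]

/-- Below `2^(m+1)` rounding is the identity. [cite: IEEE7542019, §4.3.1] -/
theorem rneSigMag_of_lt {m n : ℕ} (h : n < 2 ^ (m + 1)) : rneSigMag m n = n := by
  unfold rneSigMag; rw [if_pos h]

/-- `rneZ` on a natural number. [folklore] -/
theorem rneZ_natCast (m n : ℕ) : rneZ m (n : ℤ) = (rneSigMag m n : ℤ) := by
  unfold rneZ; rw [if_neg (by omega), Int.natAbs_natCast]

variable {φ : Format}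

/-- Range bookkeeping on the quarter grid: `K < 2^(m+12)` and `2^(m+10) ≤ maxRat` give
`K/4 ≤ maxRat`. [folklore] -/
theorem quarter_le_maxRat (hR : (2 : ℚ) ^ (φ.manBits + 10) ≤ φ.maxRat) {K : ℕ}
    (hK : K < 2 ^ (φ.manBits + 10 + 2)) : (K : ℚ) / 4 ≤ φ.maxRat := by
  have h := grid_le_maxRat_of_lt (G := 2) (E := 10) hR (K := (K : ℤ))
    (by rw [Int.natAbs_natCast]; exact hK)
  rw [Int.natAbs_natCast] at h
  norm_num at h
  exact h

/-- THE QUARTER BRIDGE on natural numbers: `fl_φ(K/4) = rneSigMag m K / 4`. [folklore] -/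
theorem roundNE_quarter_nat (hq : φ.qexp ≤ -2) (hR : (2 : ℚ) ^ (φ.manBits + 10) ≤ φ.maxRat)
    {K : ℕ} (hK : K < 2 ^ (φ.manBits + 10 + 2)) :
    (roundNE φ ((K : ℚ) / 4)).toRat = (rneSigMag φ.manBits K : ℚ) / 4 := by
  have h := toRat_roundNE_quarter_prec hq (K : ℤ)
    (by rw [Int.natAbs_natCast]; exact quarter_le_maxRat hR hK)
  rw [rneZ_natCast, Int.cast_natCast, Int.cast_natCast] at h
  exact h

/-- ONE VALUE STEP from an integer step: if `a + c = K` (quarter units), `K` is in range and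
`rneSigMag m K = b`, then `fl_φ(a/4 + c/4) = b/4` and `|a/4 + c/4| ≤ maxRat`. [folklore] -/
theorem value_step (hq : φ.qexp ≤ -2) (hR : (2 : ℚ) ^ (φ.manBits + 10) ≤ φ.maxRat)
    {a K b : ℕ} {c : ℤ} (hK : (a : ℤ) + c = K) (hKlt : K < 2 ^ (φ.manBits + 10 + 2))
    (hround : rneSigMag φ.manBits K = b) :
    (roundNE φ ((a : ℚ) / 4 + (c : ℚ) / 4)).toRat = (b : ℚ) / 4 ∧
      |(a : ℚ) / 4 + (c : ℚ) / 4| ≤ φ.maxRat := by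
  have e : (a : ℚ) / 4 + (c : ℚ) / 4 = ((K : ℕ) : ℚ) / 4 := by
    have hK' : (a : ℚ) + (c : ℚ) = (K : ℚ) := by exact_mod_cast hK
    rw [← hK']; ring
  refine ⟨by rw [e, roundNE_quarter_nat hq hR hKlt, hround], ?_⟩
  rw [e, abs_of_nonneg (by positivity)]
  exact quarter_le_maxRat hR hKlt

/-! ### The family and its trajectory (quarter units; `N = 2^(p-2)`, `2^manBits = 2N`) -/

/-- The letters in quarter units (see the module docstring). [cell, gemm.tex Thm. t:thetap (iv)] -/
def famZ (N k : ℕ) : ℤ :=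
  if k ≤ 2 * N then 2
  else if k = 2 * N + 1 then 1
  else if k ≤ 3 * N + 1 then 3
  else if k ≤ 5 * N then (if (k - (3 * N + 2)) % 2 = 0 then 2 else 3)
  else if k ≤ 7 * N then (if (k - (5 * N + 1)) % 2 = 0 then 6 else 4)
  else if k ≤ 9 * N then (if (k - (7 * N + 1)) % 2 = 0 then 9 else 8)
  else if k ≤ 11 * N then (if (k - (9 * N + 1)) % 2 = 0 then 18 else 16)
  else if k ≤ 13 * N then (if (k - (11 * N + 1)) % 2 = 0 then 36 else 32)
  else if k = 13 * N + 1 then 72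
  else if k = 13 * N + 2 then 64
  else -64

/-- The accumulator after letter `k`, in quarter units: `2k+2` on the exact prefix, then one grid
step per letter in binades `0, …, 5` (`4k-4N`, `8k-24N`, `16k-80N`, `32k-224N`, `64k-576N`),
`256N+128`, and `256N+256` forever. [cell] -/
def trajN (N k : ℕ) : ℕ :=
  if k ≤ 2 * N then 2 * k + 2
  else if k ≤ 5 * N then 4 * k - 4 * N
  else if k ≤ 7 * N then 8 * k - 24 * N
  else if k ≤ 9 * N then 16 * k - 80 * N
  else if k ≤ 11 * N then 32 * k - 224 * N
  else if k ≤ 13 * N then 64 * k - 576 * N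
  else if k = 13 * N + 1 then 256 * N + 128
  else 256 * N + 256

/-- The family as rational data (values = quarter units `/ 4`). [cell] -/
def fam (N k : ℕ) : ℚ := (famZ N k : ℚ) / 4

/-- The trajectory as rational values. [cell] -/
def traj (N k : ℕ) : ℚ := (trajN N k : ℚ) / 4

/-! ### Letter and trajectory values by block (all by `omega`) -/

/-- Prefix block: the first `2N+1` letters are `2` (value `½`). [cell] -/
theorem famZ_P1 {N k : ℕ} (h : k ≤ 2 * N) : famZ N k = 2 := by
  unfold famZ; rw [if_pos h]

/-- Prefix block: letter `2N+1` is `1` (value `¼`, the onset tie). [cell] -/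
theorem famZ_P2 (N : ℕ) : famZ N (2 * N + 1) = 1 := by
  unfold famZ; split_ifs <;> omega

/-- Binade 0, first half: `N` letters `3` (value `¾`). [cell] -/
theorem famZ_B0 {N k : ℕ} (h1 : 2 * N + 2 ≤ k) (h2 : k ≤ 3 * N + 1) : famZ N k = 3 := by
  unfold famZ; split_ifs <;> omega

/-- Binade 0, second half: `(2,3)` alternating, offset form. [cell] -/
theorem famZ_B1 (N e : ℕ) (he : e < 2 * N - 1) :
    famZ N (3 * N + 2 + e) = if e % 2 = 0 then 2 else 3 := by
  unfold famZ; split_ifs <;> omega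

/-- Binade 1: `(6,4)` alternating, offset form. [cell] -/
theorem famZ_B2 (N e : ℕ) (he : e < 2 * N) :
    famZ N (5 * N + 1 + e) = if e % 2 = 0 then 6 else 4 := by
  unfold famZ; split_ifs <;> omega

/-- Binade 2: `(9,8)` alternating, offset form. [cell] -/
theorem famZ_B3 (N e : ℕ) (he : e < 2 * N) :
    famZ N (7 * N + 1 + e) = if e % 2 = 0 then 9 else 8 := by
  unfold famZ; split_ifs <;> omega

/-- Binade 3: `(18,16)` alternating, offset form. [cell] -/
theorem famZ_B4 (N e : ℕ) (he : e < 2 * N) :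
    famZ N (9 * N + 1 + e) = if e % 2 = 0 then 18 else 16 := by
  unfold famZ; split_ifs <;> omega

/-- Binade 4: `(36,32)` alternating, offset form. [cell] -/
theorem famZ_B5 (N e : ℕ) (he : e < 2 * N) :
    famZ N (11 * N + 1 + e) = if e % 2 = 0 then 36 else 32 := by
  unfold famZ; split_ifs <;> omega

/-- Binade 5: the letter `72` (value `18`). [cell] -/
theorem famZ_B6a {N : ℕ} (hN : 1 ≤ N) : famZ N (13 * N + 1) = 72 := by
  unfold famZ; split_ifs <;> omega

/-- Binade 5: the letter `64` (value `16`) reaching `v°`. [cell] -/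
theorem famZ_B6b {N : ℕ} (hN : 1 ≤ N) : famZ N (13 * N + 2) = 64 := by
  unfold famZ; split_ifs <;> omega

/-- The absorbed tail: every later letter is `-64` (value `-16`). [cell] -/
theorem famZ_tail {N k : ℕ} (h : 13 * N + 3 ≤ k) : famZ N k = -64 := by
  unfold famZ; split_ifs <;> omega

/-- Every prefix letter is positive. [cell] -/
theorem famZ_pos {N k : ℕ} (h : k ≤ 13 * N + 2) : 0 < famZ N k := by
  unfold famZ; split_ifs <;> omega

/-- Every letter is bounded by `72` in magnitude. [cell] -/
theorem famZ_le (N k : ℕ) : famZ N k ≤ 72 ∧ -64 ≤ famZ N k := by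
  unfold famZ; split_ifs <;> omega

/-- Trajectory on the prefix block: exact sums `2k+2`. [cell] -/
theorem trajN_T0 {N k : ℕ} (h : k ≤ 2 * N) : trajN N k = 2 * k + 2 := by
  unfold trajN; rw [if_pos h]

/-- Trajectory through binade 0: one quarter step per letter. [cell] -/
theorem trajN_T1 {N k : ℕ} (h1 : 2 * N + 1 ≤ k) (h2 : k ≤ 5 * N) : trajN N k = 4 * k - 4 * N := by
  unfold trajN; split_ifs <;> omega

/-- Trajectory through binade 1: spacing 2 (quarter units). [cell] -/
theorem trajN_T2 {N k : ℕ} (hN : 1 ≤ N) (h1 : 5 * N ≤ k) (h2 : k ≤ 7 * N) : trajN N k = 8 * k - 24 * N := by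
  unfold trajN; split_ifs <;> omega

/-- Trajectory through binade 2: spacing 4. [cell] -/
theorem trajN_T3 {N k : ℕ} (hN : 1 ≤ N) (h1 : 7 * N ≤ k) (h2 : k ≤ 9 * N) : trajN N k = 16 * k - 80 * N := by
  unfold trajN; split_ifs <;> omega

/-- Trajectory through binade 3: spacing 8. [cell] -/
theorem trajN_T4 {N k : ℕ} (hN : 1 ≤ N) (h1 : 9 * N ≤ k) (h2 : k ≤ 11 * N) :
    trajN N k = 32 * k - 224 * N := by
  unfold trajN; split_ifs <;> omega

/-- Trajectory through binade 4: spacing 16. [cell] -/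
theorem trajN_T5 {N k : ℕ} (hN : 1 ≤ N) (h1 : 11 * N ≤ k) (h2 : k ≤ 13 * N) :
    trajN N k = 64 * k - 576 * N := by
  unfold trajN; split_ifs <;> omega

/-- Trajectory in binade 5 after the letter `72`. [cell] -/
theorem trajN_T6 {N : ℕ} (hN : 1 ≤ N) : trajN N (13 * N + 1) = 256 * N + 128 := by
  unfold trajN; split_ifs <;> omega

/-- The final state `v° = 256N+256` quarter-quarter units (value `64N+64`), kept forever. [cell] -/
theorem trajN_T7 {N k : ℕ} (h : 13 * N + 2 ≤ k) : trajN N k = 256 * N + 256 := by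
  unfold trajN; split_ifs <;> omega

/-- Every state is below `256N + 256 < 2^(m+12) = 8192N`. [cell] -/
theorem trajN_le (N k : ℕ) : trajN N k ≤ 256 * N + 256 := by
  unfold trajN; split_ifs <;> omega

/-! ### The 13N+2 roundings of the prefix, and the absorbed tail -/

/-- `N ≥ 1`, `2^(m+12) = 8192N`, `2^(m+1) = 4N`. [folklore] -/
theorem pow_facts {N : ℕ} (hM : 2 ^ φ.manBits = 2 * N) :
    1 ≤ N ∧ 2 ^ (φ.manBits + 10 + 2) = 8192 * N ∧ 2 ^ (φ.manBits + 1) = 4 * N := by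
  have h1 : 1 ≤ 2 ^ φ.manBits := Nat.one_le_two_pow
  refine ⟨by omega, ?_, ?_⟩
  · rw [show 2 ^ (φ.manBits + 10 + 2) = 2 ^ φ.manBits * 4096 by ring, hM]; ring
  · rw [pow_succ, hM]; ring

/-! ### Mass of the prefix: `Σ_{k ≤ 13N+2} famZ k = 141N + 136` -/

/-- Alternating sums of even length. [folklore] -/
theorem sum_alt_even (a b : ℤ) (n : ℕ) :
    ∑ e ∈ range (2 * n), (if e % 2 = 0 then a else b) = n * (a + b) := by
  induction n with
  | zero => simp
  | succ n ih =>
    rw [show 2 * (n + 1) = 2 * n + 1 + 1 by ring, sum_range_succ, sum_range_succ, ih,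
      if_pos (by omega), if_neg (by omega)]
    push_cast; ring

/-- Alternating sums of odd length. [folklore] -/
theorem sum_alt_odd (a b : ℤ) (n : ℕ) :
    ∑ e ∈ range (2 * n + 1), (if e % 2 = 0 then a else b) = n * (a + b) + a := by
  rw [sum_range_succ, sum_alt_even, if_pos (by omega)]

/-- THE MASS OF THE PREFIX in quarter units: `(4N+2) + 1 + 3N + (5N-3) + 10N + 17N + 34N + 68N
+ 136 = 141N + 136`. [cell, gemm.tex Thm. t:thetap (iv): `L°_p = 141·2^{p-4} + 34`] -/
theorem sum_famZ {N : ℕ} (hN : 1 ≤ N) : ∑ k ∈ range (13 * N + 3), famZ N k = 141 * N + 136 := by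
  obtain ⟨N', rfl⟩ : ∃ N', N = N' + 1 := ⟨N - 1, by omega⟩
  have eP1 : ∑ k ∈ range (2 * (N' + 1) + 1), famZ (N' + 1) k = 2 * (2 * (N' + 1) + 1 : ℕ) := by
    rw [sum_congr rfl (fun k hk => famZ_P1 (N := N' + 1) (by have := mem_range.mp hk; omega)),
      sum_const, card_range, nsmul_eq_mul]
    push_cast; ring
  have eB0 : ∑ e ∈ range (N' + 1), famZ (N' + 1) (2 * (N' + 1) + 2 + e) = 3 * (N' + 1 : ℕ) := by
    rw [sum_congr rfl (fun e he => famZ_B0 (N := N' + 1) (by omega)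
      (by have := mem_range.mp he; omega)), sum_const, card_range, nsmul_eq_mul]
    push_cast; ring
  have eB1 : ∑ e ∈ range (2 * N' + 1), famZ (N' + 1) (3 * (N' + 1) + 2 + e) = N' * 5 + 2 := by
    rw [sum_congr rfl (fun e he => famZ_B1 (N' + 1) e (by have := mem_range.mp he; omega)),
      sum_alt_odd]; norm_num
  have eB2 : ∑ e ∈ range (2 * (N' + 1)), famZ (N' + 1) (5 * (N' + 1) + 1 + e) = (N' + 1 : ℕ) * 10 := by
    rw [sum_congr rfl (fun e he => famZ_B2 (N' + 1) e (mem_range.mp he)), sum_alt_even]; norm_num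
  have eB3 : ∑ e ∈ range (2 * (N' + 1)), famZ (N' + 1) (7 * (N' + 1) + 1 + e) = (N' + 1 : ℕ) * 17 := by
    rw [sum_congr rfl (fun e he => famZ_B3 (N' + 1) e (mem_range.mp he)), sum_alt_even]; norm_num
  have eB4 : ∑ e ∈ range (2 * (N' + 1)), famZ (N' + 1) (9 * (N' + 1) + 1 + e) = (N' + 1 : ℕ) * 34 := by
    rw [sum_congr rfl (fun e he => famZ_B4 (N' + 1) e (mem_range.mp he)), sum_alt_even]; norm_num
  have eB5 : ∑ e ∈ range (2 * (N' + 1)), famZ (N' + 1) (11 * (N' + 1) + 1 + e) = (N' + 1 : ℕ) * 68 := by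
    rw [sum_congr rfl (fun e he => famZ_B5 (N' + 1) e (mem_range.mp he)), sum_alt_even]; norm_num
  rw [show 13 * (N' + 1) + 3 = (13 * (N' + 1) + 2) + 1 by ring, sum_range_succ, famZ_B6b hN,
    show 13 * (N' + 1) + 2 = (13 * (N' + 1) + 1) + 1 by ring, sum_range_succ, famZ_B6a hN,
    show 13 * (N' + 1) + 1 = (11 * (N' + 1) + 1) + 2 * (N' + 1) by ring, sum_range_add, eB5,
    show 11 * (N' + 1) + 1 = (9 * (N' + 1) + 1) + 2 * (N' + 1) by ring, sum_range_add, eB4,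
    show 9 * (N' + 1) + 1 = (7 * (N' + 1) + 1) + 2 * (N' + 1) by ring, sum_range_add, eB3,
    show 7 * (N' + 1) + 1 = (5 * (N' + 1) + 1) + 2 * (N' + 1) by ring, sum_range_add, eB2,
    show 5 * (N' + 1) + 1 = (3 * (N' + 1) + 2) + (2 * N' + 1) by ring, sum_range_add, eB1,
    show 3 * (N' + 1) + 2 = (2 * (N' + 1) + 2) + (N' + 1) by ring, sum_range_add, eB0,
    show 2 * (N' + 1) + 2 = (2 * (N' + 1) + 1) + 1 by ring, sum_range_succ, famZ_P2, eP1]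
  push_cast; ring

/-! ### The letters are products of E2M1 data -/

/-- The fourteen letter values. [cell] -/
theorem famZ_values (N k : ℕ) : famZ N k = 2 ∨ famZ N k = 1 ∨ famZ N k = 3 ∨ famZ N k = 6 ∨
    famZ N k = 4 ∨ famZ N k = 9 ∨ famZ N k = 8 ∨ famZ N k = 18 ∨ famZ N k = 16 ∨ famZ N k = 36 ∨
    famZ N k = 32 ∨ famZ N k = 72 ∨ famZ N k = 64 ∨ famZ N k = -64 := by
  unfold famZ; split_ifs <;> simp

/-- EVERY LETTER IS A PRODUCT OF TWO E2M1 DATA (`½ = 1·½`, `¼ = ½·½`, `¾ = ½·(3/2)`, `3/2`, `1`,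
`9/4 = (3/2)²`, `2`, `9/2 = 3·(3/2)`, `4`, `9 = 3·3`, `8 = 2·4`, `18 = 3·6`, `±16 = ±4·4`).
[cell; `piE2M1` of `GemmTieChains`, `exists_mul_eq_of_mem_piE2M1`] -/
theorem fam_mem (N k : ℕ) : fam N k ∈ piE2M1 := by
  unfold fam
  rcases famZ_values N k with h | h | h | h | h | h | h | h | h | h | h | h | h | h <;>
    rw [h] <;> norm_num [piE2M1]

/-- … hence of the form `a·b` with `a b : E2M1`. [cell] -/
theorem fam_letters (N k : ℕ) : ∃ a b : MiniFloat Format.E2M1, a.toRat * b.toRat = fam N k :=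
  exists_mul_eq_of_mem_piE2M1 _ (fam_mem N k)

end Summit.Ventures.CertifiedArithmetic.LowPrec.Gemm
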